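import Mathlib
import Summits.Ventures.HodgeRepro2.T5CyclotomicSubfieldHeckeCommutative
import Summits.Ventures.HodgeRepro2.T5CyclotomicTwentyOneSatake

/-!
# THE RECORD'S HECKE ALGEBRA ON THE NON-CYCLOTOMIC SEXTIC FIELD `ℚ(ζ₂₁)^{⟨σ₁₃⟩}`: COMMUTATIVE AT EVERY PLACE
# PRIME TO `21`, `k[X]` ABOVE `2`, `5`, `29`, `41`

Tier-5 support N3 / §G-N4.2 (seat p3, gen 82). File 304 makes the exceptional set of the record's Hecke
commutativity explicit for every CM subfield of `ℚ(ζₘ)`; this file reads it on the non-cyclotomic sextic Galois CM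
field `F = ℚ(ζ₂₁)^{⟨σ₁₃⟩}` of files 288–291 (the `fixedField` of `T5CyclotomicTwentyOneSextic`), with the census of
file 289 supplying the places that stay prime:

* `isCMField_cyclotomic` — `ℚ(ζ₂₁)` is a CM field (Mathlib's `IsCyclotomicExtension.Rat.isCMField`);
* **`recordCommutative_of_coprime`** — `H(U(1 ⊗ H), K_v)` is commutative at every place `v` of `F⁺` above a prime
  `p ∤ 21` (good for `H`); **`recordCommutative_of_notMem`** — the intrinsic form, `21 ∉ v`;
* **`recordPolynomial_two`**, **`recordPolynomial_five`**, **`recordPolynomial_twentyNine`**,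
  **`recordPolynomial_fortyOne`** — `H(U(1 ⊗ H), K_v) ≃ k[X]` at the places of `F⁺` above `2` and `5` (inert,
  `f(v/p) = 3`) and above `29` and `41` (degree-one inert places, `f(v/p) = 1`), read off file 289's census.

The hypothesis set of file 304 is thereby inhabited on a non-cyclotomic abelian CM field, in both regimes of the
inert place (README §10.5 (ii)(c)/(d)). §8(d): uses an L-value-free non-vanishing device: NO.
-/

open Matrix NumberField NumberField.IsCMField IsDedekindDomain IsDedekindDomain.HeightOneSpectrum Module Polynomial
  Ideal
open scoped TensorProduct Pointwise
open Summit.Ventures.HodgeRepro2.T5UnitaryGroupForm Summit.Ventures.HodgeRepro2.T5UnitaryHeckeAdjoint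
  Summit.Ventures.HodgeRepro2.T5HeckePermutationModule Summit.Ventures.HodgeRepro2.T5HeckeDoubleCoset
  Summit.Ventures.HodgeRepro2.T5RecordHyperspecial Summit.Ventures.HodgeRepro2.T5GlobalLatticeAlmostAll
  Summit.Ventures.HodgeRepro2.T5FinitePlaceSplitClassification Summit.Ventures.HodgeRepro2.T5RecordSatakeIntrinsic
  Summit.Ventures.HodgeRepro2.T5SplitPlaceUnitaryGroup Summit.Ventures.HodgeRepro2.T5NonSplitPlaceUnitaryGroup
  Summit.Ventures.HodgeRepro2.T5FinitePlaceCM Summit.Ventures.HodgeRepro2.T5StarOfInvolution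
  Summit.Ventures.HodgeRepro2.T5CyclotomicSevenHeckeCommutative
  Summit.Ventures.HodgeRepro2.T5CyclotomicSubfieldHeckeCommutative
  Summit.Ventures.HodgeRepro2.T5CyclotomicTwentyOneSextic Summit.Ventures.HodgeRepro2.T5CyclotomicTwentyOneCensus

namespace Summit.Ventures.HodgeRepro2.T5CyclotomicTwentyOneHecke

variable (L : Type*) [Field L] [NumberField L] [IsCyclotomicExtension {21} ℚ L]

/-- **`ℚ(ζ₂₁)` is a CM field** (Mathlib's `IsCyclotomicExtension.Rat.isCMField`, `2 < 21`). -/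
theorem isCMField_cyclotomic : IsCMField L :=
  IsCyclotomicExtension.Rat.isCMField L (S := {21}) ⟨21, Set.mem_singleton 21, by norm_num⟩

section Commutative

variable (p : ℕ) [hp : Fact p.Prime] (hpm : p.Coprime 21)
  (P : Ideal (𝓞 (fixedField L))) [hP : P.IsPrime] [hPp : P.LiesOver (span {(p : ℤ)})]
  (v : HeightOneSpectrum (𝓞 (maximalRealSubfield (fixedField L)))) [hPv : P.LiesOver v.asIdeal]

include hpm hP hPp hPv in
/-- **THE RECORD'S HECKE ALGEBRA ON `F = ℚ(ζ₂₁)^{⟨σ₁₃⟩}` IS COMMUTATIVE AT EVERY PLACE OF `F⁺` ABOVE A PRIME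
`p ∤ 21`**, for every hermitian `H` with unit determinant good above `v`, every generator family `l` and every field
`k` (file 304's `recordCommutative_cyclotomic_subfield` on `F ⊆ ℚ(ζ₂₁)`). -/
theorem recordCommutative_of_coprime {r : ℕ} (l : Fin r → 𝓞 (fixedField L)) (k : Type*) [Field k]
    (hl : Submodule.span (𝓞 (maximalRealSubfield (fixedField L))) (Set.range l) = ⊤) :
    haveI := isCMField_fixedField L
    ∀ {H : Matrix (Fin 3) (Fin 3) (fixedField L)}, H.IsHermitian → IsUnit H.det →
    (∀ w : HeightOneSpectrum (𝓞 (fixedField L)), w.asIdeal.LiesOver v.asIdeal → w ∉ badSet H) →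
    RecordCommutative (fixedField L) v l k H := by
  haveI := isCMField_fixedField L
  haveI := isCMField_cyclotomic L
  intro H hH hdet hbad
  exact recordCommutative_cyclotomic_subfield 21 L (fixedField L) p hpm P v l k hl hH hdet hbad

end Commutative

section Intrinsic

variable (v : HeightOneSpectrum (𝓞 (maximalRealSubfield (fixedField L))))

/-- **THE INTRINSIC FORM: commutative at every place `v` of `F⁺` with `21 ∉ v`** (file 304's
`recordCommutative_cyclotomic_subfield_of_notMem`). -/
theorem recordCommutative_of_notMem (h21 : ((21 : ℕ) : 𝓞 (maximalRealSubfield (fixedField L))) ∉ v.asIdeal)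
    {r : ℕ} (l : Fin r → 𝓞 (fixedField L)) (k : Type*) [Field k]
    (hl : Submodule.span (𝓞 (maximalRealSubfield (fixedField L))) (Set.range l) = ⊤) :
    haveI := isCMField_fixedField L
    ∀ {H : Matrix (Fin 3) (Fin 3) (fixedField L)}, H.IsHermitian → IsUnit H.det →
    (∀ w : HeightOneSpectrum (𝓞 (fixedField L)), w.asIdeal.LiesOver v.asIdeal → w ∉ badSet H) →
    RecordCommutative (fixedField L) v l k H := by
  haveI := isCMField_fixedField L
  haveI := isCMField_cyclotomic L
  intro H hH hdet hbad
  exact recordCommutative_cyclotomic_subfield_of_notMem 21 L (fixedField L) v h21 l k hl hH hdet hbad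

end Intrinsic

section Polynomial

variable (v : HeightOneSpectrum (𝓞 (maximalRealSubfield (fixedField L))))

/-- **`k[X]` AT THE PLACES OF `F⁺` ABOVE `2`** (`2` is inert in `F`, file 289's `census_two`; `q = 8`). -/
theorem recordPolynomial_two (P : Ideal (𝓞 (fixedField L))) [hP : P.IsPrime]
    [hPp : P.LiesOver (span {(2 : ℤ)})] [hPv : P.LiesOver v.asIdeal]
    {r : ℕ} (l : Fin r → 𝓞 (fixedField L)) (k : Type*) [Field k]
    (hl : Submodule.span (𝓞 (maximalRealSubfield (fixedField L))) (Set.range l) = ⊤) :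
    haveI := isCMField_fixedField L
    ∀ {H : Matrix (Fin 3) (Fin 3) (fixedField L)}, H.IsHermitian → IsUnit H.det →
    (∀ w : HeightOneSpectrum (𝓞 (fixedField L)), w.asIdeal.LiesOver v.asIdeal → w ∉ badSet H) →
    RecordPolynomial (fixedField L) v l k H := by
  haveI := isCMField_fixedField L
  intro H hH hdet hbad
  obtain ⟨w, hmap⟩ := (census_two L P v).2.2
  exact recordPolynomial_of_map_eq (fixedField L) v l k w hmap hl hH hdet
    (hbad w (liesOver_of_map_eq (fixedField L) v w hmap))

/-- **`k[X]` AT THE PLACES OF `F⁺` ABOVE `5`** (`5` is inert in `F`, file 289's `census_five`; `q = 125`). -/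
theorem recordPolynomial_five (P : Ideal (𝓞 (fixedField L))) [hP : P.IsPrime]
    [hPp : P.LiesOver (span {(5 : ℤ)})] [hPv : P.LiesOver v.asIdeal]
    {r : ℕ} (l : Fin r → 𝓞 (fixedField L)) (k : Type*) [Field k]
    (hl : Submodule.span (𝓞 (maximalRealSubfield (fixedField L))) (Set.range l) = ⊤) :
    haveI := isCMField_fixedField L
    ∀ {H : Matrix (Fin 3) (Fin 3) (fixedField L)}, H.IsHermitian → IsUnit H.det →
    (∀ w : HeightOneSpectrum (𝓞 (fixedField L)), w.asIdeal.LiesOver v.asIdeal → w ∉ badSet H) →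
    RecordPolynomial (fixedField L) v l k H := by
  haveI := isCMField_fixedField L
  intro H hH hdet hbad
  obtain ⟨w, hmap⟩ := (census_five L P v).2.2
  exact recordPolynomial_of_map_eq (fixedField L) v l k w hmap hl hH hdet
    (hbad w (liesOver_of_map_eq (fixedField L) v w hmap))

/-- **`k[X]` AT THE PLACES OF `F⁺` ABOVE `29`** (a degree-one inert place, file 289's `census_twentyNine`;
`q = 29`). -/
theorem recordPolynomial_twentyNine (P : Ideal (𝓞 (fixedField L))) [hP : P.IsPrime]
    [hPp : P.LiesOver (span {(29 : ℤ)})] [hPv : P.LiesOver v.asIdeal]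
    {r : ℕ} (l : Fin r → 𝓞 (fixedField L)) (k : Type*) [Field k]
    (hl : Submodule.span (𝓞 (maximalRealSubfield (fixedField L))) (Set.range l) = ⊤) :
    haveI := isCMField_fixedField L
    ∀ {H : Matrix (Fin 3) (Fin 3) (fixedField L)}, H.IsHermitian → IsUnit H.det →
    (∀ w : HeightOneSpectrum (𝓞 (fixedField L)), w.asIdeal.LiesOver v.asIdeal → w ∉ badSet H) →
    RecordPolynomial (fixedField L) v l k H := by
  haveI := isCMField_fixedField L
  intro H hH hdet hbad
  obtain ⟨w, hmap⟩ := (census_twentyNine L P v).2.2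
  exact recordPolynomial_of_map_eq (fixedField L) v l k w hmap hl hH hdet
    (hbad w (liesOver_of_map_eq (fixedField L) v w hmap))

/-- **`k[X]` AT THE PLACES OF `F⁺` ABOVE `41`** (a degree-one inert place, file 289's `census_fortyOne`;
`q = 41`). -/
theorem recordPolynomial_fortyOne (P : Ideal (𝓞 (fixedField L))) [hP : P.IsPrime]
    [hPp : P.LiesOver (span {(41 : ℤ)})] [hPv : P.LiesOver v.asIdeal]
    {r : ℕ} (l : Fin r → 𝓞 (fixedField L)) (k : Type*) [Field k]
    (hl : Submodule.span (𝓞 (maximalRealSubfield (fixedField L))) (Set.range l) = ⊤) :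
    haveI := isCMField_fixedField L
    ∀ {H : Matrix (Fin 3) (Fin 3) (fixedField L)}, H.IsHermitian → IsUnit H.det →
    (∀ w : HeightOneSpectrum (𝓞 (fixedField L)), w.asIdeal.LiesOver v.asIdeal → w ∉ badSet H) →
    RecordPolynomial (fixedField L) v l k H := by
  haveI := isCMField_fixedField L
  intro H hH hdet hbad
  obtain ⟨w, hmap⟩ := (census_fortyOne L P v).2.2
  exact recordPolynomial_of_map_eq (fixedField L) v l k w hmap hl hH hdet
    (hbad w (liesOver_of_map_eq (fixedField L) v w hmap))

end Polynomial

end Summit.Ventures.HodgeRepro2.T5CyclotomicTwentyOneHecke
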